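import Literature.Probability.Percolation.RSWProofs
import Literature.Probability.Percolation.PlanarDuality
import Literature.Probability.Percolation.CrossingChains
import HarnessLib

/-!
# Crux `StripClusterRates` (stmt-CriticalPhenomena-13878), line two-cluster-rate-is-stationary-gap, reshape 5 (lead c6):
registered stub `stub_cgGluePlus`

Support file (`--supports stmt-CriticalPhenomena-13878`). See the skeleton
`Cruxes/StripClusterRates/Lines/two_cluster_rate_is_stationary_gap.lean`, section `ConfinedGluing`, for the role of this stub in
the confined-gluing order transfer (γ₂-half of the crux from Cardy-order two-cluster Kac).
-/

noncomputable section

open MeasureTheory Filter Topology Set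
open Literature.Probability.LatticeModels Literature.Probability.Percolation

namespace Summit.CriticalPhenomena.CardyFormulaZ2.Cruxes.StripClusterRates.TwoClusterRateIsStationaryGap

/-! ## Helpers: symmetry, translated events in image form, and the one-band gluing lemma -/

/-- Symmetry of the restricted connection event `{x ↔ y in S}`, as an implication. [folklore] -/
theorem cgGluePlus_conn_symm {S : Set (Site 2)} {x y : Site 2} {ω : BondConfig (Site 2)}
    (h : ω ∈ openConnIn S x y) : ω ∈ openConnIn S y x := by
  rw [openConnIn_comm]; exact h

/-- Translated crossing events: from the preimage form "`ω - v ∈ C(S; A, B)`" to the image form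
`ω ∈ C(S + v; A + v, B + v)`. [folklore] -/
theorem cgGluePlus_mem_openCrossing_image {ω : BondConfig (Site 2)} {v : Site 2} {S A B : Set (Site 2)}
    (h : ω ∈ (BondConfig.relabel (sym2Equiv (Site.shift (-v)))) ⁻¹' openCrossing S A B) :
    ω ∈ openCrossing ((· + v) '' S) ((· + v) '' A) ((· + v) '' B) := by
  have h' := relabel_mem_openCrossing (Site.shift v) h
  have e := relabel_shift_neg_relabel_shift (-v) ω
  rw [neg_neg] at e
  rw [e] at h'
  have hf : (⇑(Site.shift v) : Site 2 → Site 2) = (· + v) := funext (Site.shift_apply v)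
  simpa only [hf] using h'

/-- **One band of the confined gluing** (Bollobás–Riordan 2006, Ch. 3, proof of eq. (2), Fig. 7, done
twice). In the row window `[r, r + b]`: the part of the block-1 path `x₁ ↔ y₁` (inside `S₁`) after
its last visit to the column `M₁ - b` is a left-right crossing of the left end square
`[M₁ - b, M₁] × [r, r + b]`, hence meets the open vertical crossing `Q₁` of that square; so does the
initial segment (up to the column `M₁`) of the open horizontal crossing of the glue box
`[M₁ - b, M₁ + 2b + 2] × [r, r + b]`, whose final segment (after the column `M₁ + b + 2`) meets the
open vertical crossing `Q₂` of the right end square `[M₁ + b + 2, M₁ + 2b + 2] × [r, r + b]`, as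
does the initial segment (up to the column `M₁ + 2b + 2`) of the block-2 path `x₂ ↔ y₂` (inside
`S₂`). If all these regions lie in `S`, then `x₁ ↔ y₂` inside `S`. [cite: BollobasRiordan2006, Ch. 3, proof of eq. (2)] -/
theorem cgGluePlus_band {ω : BondConfig (Site 2)} (hω : ω ⊆ (zdGraph 2).edgeSet)
    {M₁ b : ℕ} {r : ℤ} {S₁ S₂ S : Set (Site 2)} {x₁ y₁ x₂ y₂ : Site 2}
    (h₁ : ω ∈ openConnIn S₁ x₁ y₁) (hx₁ : x₁ 0 ≤ (M₁ : ℤ) - b) (hy₁ : y₁ 0 = M₁)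
    (hS₁ : ∀ z ∈ S₁, (M₁ : ℤ) - b ≤ z 0 → z 0 ≤ M₁ ∧ r ≤ z 1 ∧ z 1 ≤ r + b) (hS₁S : S₁ ⊆ S)
    (h₂ : ω ∈ openConnIn S₂ x₂ y₂) (hx₂ : x₂ 0 = (M₁ : ℤ) + b + 2) (hy₂ : (M₁ : ℤ) + 2 * b + 2 ≤ y₂ 0)
    (hS₂ : ∀ z ∈ S₂, z 0 ≤ (M₁ : ℤ) + 2 * b + 2 → (M₁ : ℤ) + b + 2 ≤ z 0 ∧ r ≤ z 1 ∧ z 1 ≤ r + b)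
    (hS₂S : S₂ ⊆ S)
    (hGS : ∀ z : Site 2, (M₁ : ℤ) - b ≤ z 0 → z 0 ≤ (M₁ : ℤ) + 2 * b + 2 → r ≤ z 1 → z 1 ≤ r + b → z ∈ S)
    (hH : ω ∈ lrCrossingAt (pt ((M₁ : ℤ) - b) r) (3 * b + 2) b)
    (hV₁ : ω ∈ openCrossing ((· + pt ((M₁ : ℤ) - b) r) '' (rectangle b b : Set (Site 2)))
      ((· + pt ((M₁ : ℤ) - b) r) '' (bottomSide b b : Set (Site 2)))
      ((· + pt ((M₁ : ℤ) - b) r) '' (topSide b b : Set (Site 2))))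
    (hV₂ : ω ∈ openCrossing ((· + pt ((M₁ : ℤ) + b + 2) r) '' (rectangle b b : Set (Site 2)))
      ((· + pt ((M₁ : ℤ) + b + 2) r) '' (bottomSide b b : Set (Site 2)))
      ((· + pt ((M₁ : ℤ) + b + 2) r) '' (topSide b b : Set (Site 2)))) :
    ω ∈ openConnIn S x₁ y₂ := by
  classical
  -- (1) the tail of the block-1 path after its last visit to the column `M₁ - b`
  obtain ⟨z₁, hz₁0, hyz₁⟩ := exists_openConnIn_column_ge hω ((M₁ : ℤ) - b) (by rw [hy₁]; omega) hx₁
    (cgGluePlus_conn_symm h₁)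
  obtain ⟨P₁, hP₁S, hP₁ω⟩ := exists_walk_of_mem_openConnIn hω (cgGluePlus_conn_symm hyz₁)
  have hP₁box : ∀ z ∈ P₁.support, (M₁ : ℤ) - b ≤ z 0 ∧ z 0 ≤ M₁ ∧ r ≤ z 1 ∧ z 1 ≤ r + b :=
    fun z hz => ⟨(hP₁S z hz).2, hS₁ z (hP₁S z hz).1 (hP₁S z hz).2⟩
  -- (2) the vertical crossing of the left end square, as a walk; it meets `P₁`
  obtain ⟨c₁, hc₁, d₁, hd₁, hcd₁⟩ := hV₁
  rw [mem_image_add_bottomSide] at hc₁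
  rw [mem_image_add_topSide] at hd₁
  simp only [pt, Matrix.cons_val_zero, Matrix.cons_val_one, Matrix.cons_val_fin_one] at hc₁ hd₁
  obtain ⟨Q₁, hQ₁S, hQ₁ω⟩ := exists_walk_of_mem_openConnIn hω hcd₁
  have hQ₁box : ∀ z ∈ Q₁.support, (M₁ : ℤ) - b ≤ z 0 ∧ z 0 ≤ M₁ ∧ r ≤ z 1 ∧ z 1 ≤ r + b := by
    intro z hz
    have h := mem_image_add_rectangle.1 (hQ₁S z hz)
    simp only [pt, Matrix.cons_val_zero, Matrix.cons_val_one, Matrix.cons_val_fin_one] at h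
    omega
  obtain ⟨w₁, hw₁P, hw₁Q⟩ := exists_mem_support_of_crossing (L := (M₁ : ℤ) - b) (R := M₁) (B := r)
    (T := r + b) P₁ Q₁ hP₁box hQ₁box hz₁0 hy₁ hc₁.2 hd₁.2
  -- (3) the horizontal crossing of the glue box; its head up to the column `M₁` meets `Q₁`
  obtain ⟨xh, hxh, yh, hyh, hH'⟩ := hH
  rw [mem_image_add_leftSide] at hxh
  rw [mem_image_add_rightSide] at hyh
  simp only [pt, Matrix.cons_val_zero, Matrix.cons_val_one, Matrix.cons_val_fin_one] at hxh hyh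
  push_cast at hyh
  have hGbox : ∀ z ∈ (· + pt ((M₁ : ℤ) - b) r) '' (rectangle (3 * b + 2) b : Set (Site 2)),
      (M₁ : ℤ) - b ≤ z 0 ∧ z 0 ≤ (M₁ : ℤ) + 2 * b + 2 ∧ r ≤ z 1 ∧ z 1 ≤ r + b := by
    intro z hz
    have h := mem_image_add_rectangle.1 hz
    simp only [pt, Matrix.cons_val_zero, Matrix.cons_val_one, Matrix.cons_val_fin_one] at h
    push_cast at h
    omega
  obtain ⟨zh, hzh0, hxzh⟩ := exists_openConnIn_column hω (M₁ : ℤ) (by omega) (by omega) hH'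
  obtain ⟨P₂, hP₂S, hP₂ω⟩ := exists_walk_of_mem_openConnIn hω hxzh
  have hP₂box : ∀ z ∈ P₂.support, (M₁ : ℤ) - b ≤ z 0 ∧ z 0 ≤ M₁ ∧ r ≤ z 1 ∧ z 1 ≤ r + b := by
    intro z hz
    have h := hGbox z (hP₂S z hz).1
    have h' : z 0 ≤ (M₁ : ℤ) := (hP₂S z hz).2
    omega
  obtain ⟨w₂, hw₂P, hw₂Q⟩ := exists_mem_support_of_crossing (L := (M₁ : ℤ) - b) (R := M₁) (B := r)
    (T := r + b) P₂ Q₁ hP₂box hQ₁box hxh.2 hzh0 hc₁.2 hd₁.2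
  -- (4) its tail after the last visit to the column `M₁ + b + 2`
  obtain ⟨zh', hzh'0, hyzh'⟩ := exists_openConnIn_column_ge hω ((M₁ : ℤ) + b + 2) (by omega) (by omega)
    (cgGluePlus_conn_symm hH')
  obtain ⟨P₃, hP₃S, hP₃ω⟩ := exists_walk_of_mem_openConnIn hω (cgGluePlus_conn_symm hyzh')
  have hP₃box : ∀ z ∈ P₃.support,
      (M₁ : ℤ) + b + 2 ≤ z 0 ∧ z 0 ≤ (M₁ : ℤ) + 2 * b + 2 ∧ r ≤ z 1 ∧ z 1 ≤ r + b := by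
    intro z hz
    have h := hGbox z (hP₃S z hz).1
    have h' : (M₁ : ℤ) + b + 2 ≤ z 0 := (hP₃S z hz).2
    omega
  -- (5) the vertical crossing of the right end square, as a walk; it meets `P₃`
  obtain ⟨c₂, hc₂, d₂, hd₂, hcd₂⟩ := hV₂
  rw [mem_image_add_bottomSide] at hc₂
  rw [mem_image_add_topSide] at hd₂
  simp only [pt, Matrix.cons_val_zero, Matrix.cons_val_one, Matrix.cons_val_fin_one] at hc₂ hd₂
  obtain ⟨Q₂, hQ₂S, hQ₂ω⟩ := exists_walk_of_mem_openConnIn hω hcd₂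
  have hQ₂box : ∀ z ∈ Q₂.support,
      (M₁ : ℤ) + b + 2 ≤ z 0 ∧ z 0 ≤ (M₁ : ℤ) + 2 * b + 2 ∧ r ≤ z 1 ∧ z 1 ≤ r + b := by
    intro z hz
    have h := mem_image_add_rectangle.1 (hQ₂S z hz)
    simp only [pt, Matrix.cons_val_zero, Matrix.cons_val_one, Matrix.cons_val_fin_one] at h
    omega
  obtain ⟨w₃, hw₃P, hw₃Q⟩ := exists_mem_support_of_crossing (L := (M₁ : ℤ) + b + 2)
    (R := (M₁ : ℤ) + 2 * b + 2) (B := r) (T := r + b) P₃ Q₂ hP₃box hQ₂box hzh'0 (by omega) hc₂.2 hd₂.2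
  -- (6) the head of the block-2 path up to its first visit to the column `M₁ + 2b + 2` meets `Q₂`
  obtain ⟨z₂, hz₂0, hxz₂⟩ := exists_openConnIn_column hω ((M₁ : ℤ) + 2 * b + 2) (by rw [hx₂]; omega) hy₂ h₂
  obtain ⟨P₄, hP₄S, hP₄ω⟩ := exists_walk_of_mem_openConnIn hω hxz₂
  have hP₄box : ∀ z ∈ P₄.support,
      (M₁ : ℤ) + b + 2 ≤ z 0 ∧ z 0 ≤ (M₁ : ℤ) + 2 * b + 2 ∧ r ≤ z 1 ∧ z 1 ≤ r + b := by
    intro z hz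
    have h' : z 0 ≤ (M₁ : ℤ) + 2 * b + 2 := (hP₄S z hz).2
    have h := hS₂ z (hP₄S z hz).1 h'
    omega
  obtain ⟨w₄, hw₄P, hw₄Q⟩ := exists_mem_support_of_crossing (L := (M₁ : ℤ) + b + 2)
    (R := (M₁ : ℤ) + 2 * b + 2) (B := r) (T := r + b) P₄ Q₂ hP₄box hQ₂box hx₂ hz₂0 hc₂.2 hd₂.2
  -- (7) assemble `x₁ → z₁ → w₁ → c₁ → w₂ → xh → zh' → w₃ → c₂ → w₄ → x₂ → y₂` inside `S`
  have hbox₁S : ∀ z : Site 2, (M₁ : ℤ) - b ≤ z 0 ∧ z 0 ≤ M₁ ∧ r ≤ z 1 ∧ z 1 ≤ r + b → z ∈ S :=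
    fun z h => hGS z h.1 (by omega) h.2.2.1 h.2.2.2
  have hbox₂S : ∀ z : Site 2,
      (M₁ : ℤ) + b + 2 ≤ z 0 ∧ z 0 ≤ (M₁ : ℤ) + 2 * b + 2 ∧ r ≤ z 1 ∧ z 1 ≤ r + b → z ∈ S :=
    fun z h => hGS z (by omega) h.2.1 h.2.2.1 h.2.2.2
  have hGS' : (· + pt ((M₁ : ℤ) - b) r) '' (rectangle (3 * b + 2) b : Set (Site 2)) ⊆ S :=
    fun z hz => hGS z (hGbox z hz).1 (hGbox z hz).2.1 (hGbox z hz).2.2.1 (hGbox z hz).2.2.2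
  have e₁ : ω ∈ openConnIn S x₁ z₁ :=
    PlanarDuality.openConnIn_trans (openConnIn_mono hS₁S _ _ h₁)
      (openConnIn_mono (fun z hz => hS₁S hz.1) _ _ hyz₁)
  have e₂ : ω ∈ openConnIn S z₁ w₁ :=
    mem_openConnIn_of_mem_support P₁ (fun z hz => hbox₁S z (hP₁box z hz)) hP₁ω hw₁P
  have e₃ : ω ∈ openConnIn S w₁ c₁ :=
    cgGluePlus_conn_symm (mem_openConnIn_of_mem_support Q₁ (fun z hz => hbox₁S z (hQ₁box z hz)) hQ₁ω hw₁Q)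
  have e₄ : ω ∈ openConnIn S c₁ w₂ :=
    mem_openConnIn_of_mem_support Q₁ (fun z hz => hbox₁S z (hQ₁box z hz)) hQ₁ω hw₂Q
  have e₅ : ω ∈ openConnIn S w₂ xh :=
    cgGluePlus_conn_symm (mem_openConnIn_of_mem_support P₂ (fun z hz => hbox₁S z (hP₂box z hz)) hP₂ω hw₂P)
  have e₆ : ω ∈ openConnIn S xh zh' :=
    PlanarDuality.openConnIn_trans (openConnIn_mono hGS' _ _ hH')
      (openConnIn_mono (fun z hz => hGS' hz.1) _ _ hyzh')
  have e₇ : ω ∈ openConnIn S zh' w₃ :=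
    mem_openConnIn_of_mem_support P₃ (fun z hz => hbox₂S z (hP₃box z hz)) hP₃ω hw₃P
  have e₈ : ω ∈ openConnIn S w₃ c₂ :=
    cgGluePlus_conn_symm (mem_openConnIn_of_mem_support Q₂ (fun z hz => hbox₂S z (hQ₂box z hz)) hQ₂ω hw₃Q)
  have e₉ : ω ∈ openConnIn S c₂ w₄ :=
    mem_openConnIn_of_mem_support Q₂ (fun z hz => hbox₂S z (hQ₂box z hz)) hQ₂ω hw₄Q
  have e₁₀ : ω ∈ openConnIn S w₄ x₂ :=
    cgGluePlus_conn_symm (mem_openConnIn_of_mem_support P₄ (fun z hz => hS₂S (hP₄S z hz).1) hP₄ω hw₄P)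
  have e₁₁ : ω ∈ openConnIn S x₂ y₂ := openConnIn_mono hS₂S _ _ h₂
  exact PlanarDuality.openConnIn_trans (PlanarDuality.openConnIn_trans (PlanarDuality.openConnIn_trans
    (PlanarDuality.openConnIn_trans (PlanarDuality.openConnIn_trans (PlanarDuality.openConnIn_trans
    (PlanarDuality.openConnIn_trans (PlanarDuality.openConnIn_trans (PlanarDuality.openConnIn_trans
    (PlanarDuality.openConnIn_trans e₁ e₂) e₃) e₄) e₅) e₆) e₇) e₈) e₉) e₁₀) e₁₁


/-- **CG2⁺ · deterministic gluing of the increasing parts of two end-confined blocks** (registered stub `stub_cgGluePlus` of crux `StripClusterRates`, reshape 5): block 1 `[0,M₁]`, block 2 translated by `(M₁+b+2,0)`; an open LR crossing of the bottom glue box `[M₁-b, M₁+2b+2]×[0,b]` and open TB crossings of its two end squares tie the two confined bottom paths together (and likewise on top); the result is the increasing confined event of the long block `M₁+b+2+M₂`. [folklore; cite: BollobasRiordan2006, Ch. 3, proof of eq. (2); Kesten1982, §2.2] -/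
theorem stub_cgGluePlus :
    ∀ (M₁ M₂ b : ℕ), 1 ≤ b → b + 1 ≤ M₁ → b + 1 ≤ M₂ → ∀ ω : BondConfig (Site 2), ω ⊆ (zdGraph 2).edgeSet → ω ∈ (openCrossing {z ∈ (rectangle M₁ (3 * b + 2) : Set (Site 2)) | (z 0 ≤ (b : ℤ) ∨ (M₁ : ℤ) ≤ z 0 + b) → z 1 ≤ (b : ℤ)} (leftSide M₁ (3 * b + 2) : Set (Site 2)) (rightSide M₁ (3 * b + 2) : Set (Site 2)) ∩ tbCrossing b b ∩ openCrossing {z ∈ (rectangle M₁ (3 * b + 2) : Set (Site 2)) | (z 0 ≤ (b : ℤ) ∨ (M₁ : ℤ) ≤ z 0 + b) → 2 * (b : ℤ) + 2 ≤ z 1} (leftSide M₁ (3 * b + 2) : Set (Site 2)) (rightSide M₁ (3 * b + 2) : Set (Site 2)) ∩ (BondConfig.relabel (sym2Equiv (Site.shift (-pt 0 (2 * (b : ℤ) + 2))))) ⁻¹' tbCrossing b b) → ω ∈ (BondConfig.relabel (sym2Equiv (Site.shift (-pt ((M₁ : ℤ) + b + 2) 0)))) ⁻¹' (openCrossing {z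 ∈ (rectangle M₂ (3 * b + 2) : Set (Site 2)) | (z 0 ≤ (b : ℤ) ∨ (M₂ : ℤ) ≤ z 0 + b) → z 1 ≤ (b : ℤ)} (leftSide M₂ (3 * b + 2) : Set (Site 2)) (rightSide M₂ (3 * b + 2) : Set (Site 2)) ∩ tbCrossing b b ∩ openCrossing {z ∈ (rectangle M₂ (3 * b + 2) : Set (Site 2)) | (z 0 ≤ (b : ℤ) ∨ (M₂ : ℤ) ≤ z 0 + b) → 2 * (b : ℤ) + 2 ≤ z 1} (leftSide M₂ (3 * b + 2) : Set (Site 2)) (rightSide M₂ (3 * b + 2) : Set (Site 2)) ∩ (BondConfig.relabel (sym2Equiv (Site.shift (-pt 0 (2 * (b : ℤ) + 2))))) ⁻¹' tbCrossing b b) → ω ∈ (lrCrossingAt (pt ((M₁ : ℤ) - b) 0) (3 * b + 2) b ∩ (BondConfig.relabel (sym2Equiv (Site.shift (-pt ((M₁ : ℤ) - b) 0)))) ⁻¹' tbCrossing b b ∩ (BondConfig.relabel (sym2Equiv (Site.shift (-pt ((M₁ : ℤ) + b + 2) 0)))) ⁻¹' tbCrossing b b ∩ lrCrossingAt (pt ((M₁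 : ℤ) - b) (2 * (b : ℤ) + 2)) (3 * b + 2) b ∩ (BondConfig.relabel (sym2Equiv (Site.shift (-pt ((M₁ : ℤ) - b) (2 * (b : ℤ) + 2))))) ⁻¹' tbCrossing b b ∩ (BondConfig.relabel (sym2Equiv (Site.shift (-pt ((M₁ : ℤ) + b + 2) (2 * (b : ℤ) + 2))))) ⁻¹' tbCrossing b b) → ω ∈ (openCrossing {z ∈ (rectangle (M₁ + b + 2 + M₂ : ℕ) (3 * b + 2) : Set (Site 2)) | (z 0 ≤ (b : ℤ) ∨ ((M₁ + b + 2 + M₂ : ℕ) : ℤ) ≤ z 0 + b) → z 1 ≤ (b : ℤ)} (leftSide (M₁ + b + 2 + M₂ : ℕ) (3 * b + 2) : Set (Site 2)) (rightSide (M₁ + b + 2 + M₂ : ℕ) (3 * b + 2) : Set (Site 2)) ∩ tbCrossing b b ∩ openCrossing {z ∈ (rectangle (M₁ + b + 2 + M₂ : ℕ) (3 * b + 2) : Set (Site 2)) | (z 0 ≤ (b : ℤ) ∨ ((M₁ + b + 2 + M₂ : ℕ) : ℤ) ≤ z 0 + b) → 2 * (b : ℤ) + 2 ≤ z 1} (leftSide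 (M₁ + b + 2 + M₂ : ℕ) (3 * b + 2) : Set (Site 2)) (rightSide (M₁ + b + 2 + M₂ : ℕ) (3 * b + 2) : Set (Site 2)) ∩ (BondConfig.relabel (sym2Equiv (Site.shift (-pt 0 (2 * (b : ℤ) + 2))))) ⁻¹' tbCrossing b b) := by
  intro M₁ M₂ b hb hM₁ hM₂ ω hω hF₁ hF₂ hG
  obtain ⟨⟨⟨hB₁, hTB₁⟩, hT₁⟩, hTBt₁⟩ := hF₁
  obtain ⟨⟨⟨hB₂, -⟩, hT₂⟩, -⟩ := hF₂
  have hB₂' := cgGluePlus_mem_openCrossing_image hB₂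
  have hT₂' := cgGluePlus_mem_openCrossing_image hT₂
  obtain ⟨⟨⟨⟨⟨hH, hV₁⟩, hV₂⟩, hH'⟩, hV₁'⟩, hV₂'⟩ := hG
  have hV₁i := cgGluePlus_mem_openCrossing_image hV₁
  have hV₂i := cgGluePlus_mem_openCrossing_image hV₂
  have hV₁i' := cgGluePlus_mem_openCrossing_image hV₁'
  have hV₂i' := cgGluePlus_mem_openCrossing_image hV₂'
  refine ⟨⟨⟨?_, hTB₁⟩, ?_⟩, hTBt₁⟩
  · -- the bottom band
    obtain ⟨x₁, hx₁, y₁, hy₁, h₁⟩ := hB₁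
    obtain ⟨x₂, hx₂, y₂, hy₂, h₂⟩ := hB₂'
    rw [mem_image_add_leftSide] at hx₂
    rw [mem_image_add_rightSide] at hy₂
    simp only [pt, Matrix.cons_val_zero, Matrix.cons_val_one, Matrix.cons_val_fin_one] at hx₂ hy₂
    simp only [Finset.mem_coe, leftSide, rightSide, Finset.mem_filter, mem_rectangle_iff] at hx₁ hy₁
    refine ⟨x₁, ?_, y₂, ?_, ?_⟩
    · simp only [Finset.mem_coe, leftSide, Finset.mem_filter, mem_rectangle_iff]; push_cast; omega
    · simp only [Finset.mem_coe, rightSide, Finset.mem_filter, mem_rectangle_iff]; push_cast; omega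
    refine cgGluePlus_band hω (r := 0) h₁ (by omega) hy₁.2 ?_ ?_ h₂ hx₂.2 (by push_cast at hy₂; omega) ?_ ?_ ?_
      hH hV₁i hV₂i
    · intro z hz hz0
      simp only [Set.mem_setOf_eq, Finset.mem_coe, mem_rectangle_iff] at hz
      omega
    · intro z hz
      simp only [Set.mem_setOf_eq, Finset.mem_coe, mem_rectangle_iff] at hz ⊢
      push_cast
      omega
    · intro z hz hz0
      simp only [Set.image_add_right, Set.mem_preimage, Set.mem_setOf_eq, Finset.mem_coe, mem_rectangle_iff,
        Pi.add_apply, Pi.neg_apply, pt, Matrix.cons_val_zero, Matrix.cons_val_one, Matrix.cons_val_fin_one] at hz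
      omega
    · intro z hz
      simp only [Set.image_add_right, Set.mem_preimage, Set.mem_setOf_eq, Finset.mem_coe, mem_rectangle_iff,
        Pi.add_apply, Pi.neg_apply, pt, Matrix.cons_val_zero, Matrix.cons_val_one, Matrix.cons_val_fin_one] at hz
      simp only [Set.mem_setOf_eq, Finset.mem_coe, mem_rectangle_iff]
      push_cast
      omega
    · intro z h0 h0' h1 h1'
      simp only [Set.mem_setOf_eq, Finset.mem_coe, mem_rectangle_iff]
      push_cast
      omega
  · -- the top band
    obtain ⟨x₁, hx₁, y₁, hy₁, h₁⟩ := hT₁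
    obtain ⟨x₂, hx₂, y₂, hy₂, h₂⟩ := hT₂'
    rw [mem_image_add_leftSide] at hx₂
    rw [mem_image_add_rightSide] at hy₂
    simp only [pt, Matrix.cons_val_zero, Matrix.cons_val_one, Matrix.cons_val_fin_one] at hx₂ hy₂
    simp only [Finset.mem_coe, leftSide, rightSide, Finset.mem_filter, mem_rectangle_iff] at hx₁ hy₁
    refine ⟨x₁, ?_, y₂, ?_, ?_⟩
    · simp only [Finset.mem_coe, leftSide, Finset.mem_filter, mem_rectangle_iff]; push_cast; omega
    · simp only [Finset.mem_coe, rightSide, Finset.mem_filter, mem_rectangle_iff]; push_cast; omega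
    refine cgGluePlus_band hω (r := 2 * (b : ℤ) + 2) h₁ (by omega) hy₁.2 ?_ ?_ h₂ hx₂.2
      (by push_cast at hy₂; omega) ?_ ?_ ?_ hH' hV₁i' hV₂i'
    · intro z hz hz0
      simp only [Set.mem_setOf_eq, Finset.mem_coe, mem_rectangle_iff] at hz
      push_cast at hz
      omega
    · intro z hz
      simp only [Set.mem_setOf_eq, Finset.mem_coe, mem_rectangle_iff] at hz ⊢
      push_cast at hz ⊢
      omega
    · intro z hz hz0
      simp only [Set.image_add_right, Set.mem_preimage, Set.mem_setOf_eq, Finset.mem_coe, mem_rectangle_iff,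
        Pi.add_apply, Pi.neg_apply, pt, Matrix.cons_val_zero, Matrix.cons_val_one, Matrix.cons_val_fin_one] at hz
      push_cast at hz
      omega
    · intro z hz
      simp only [Set.image_add_right, Set.mem_preimage, Set.mem_setOf_eq, Finset.mem_coe, mem_rectangle_iff,
        Pi.add_apply, Pi.neg_apply, pt, Matrix.cons_val_zero, Matrix.cons_val_one, Matrix.cons_val_fin_one] at hz
      simp only [Set.mem_setOf_eq, Finset.mem_coe, mem_rectangle_iff]
      push_cast at hz ⊢
      omega
    · intro z h0 h0' h1 h1'
      simp only [Set.mem_setOf_eq, Finset.mem_coe, mem_rectangle_iff]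
      push_cast
      omega

end Summit.CriticalPhenomena.CardyFormulaZ2.Cruxes.StripClusterRates.TwoClusterRateIsStationaryGap

end
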